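import Summits.AtomisticToContinuum.HydrodynamicLimit.Theorems.KineticFluxLdDecay.Negative.HTheoremMixtureProduction
import HarnessLib

/-!
# Refutation of the `∀ν` H-theorem budgets `NoPerpetualDissipation` and `NoPerpetualDissipationBdd`
# (crux `KineticFluxLdDecay`, stmt-AtomisticToContinuum-10967; line `h-theorem-dissipation-budget`, lead a2)

The two `∀ν` forms of the line's bet (`Theorems/AntiMazurCoboundariesKineticFluxLdDecayHTheoremObjects{,B}.lean`):

* `NoPerpetualDissipation` — for EVERY finite-entropy law `ν ≪ G_N`, the time-integrated Hellinger production
  of the reduced one-body density over the kinetic window `h = τ(N+1)^{-1/3}` is `≤ (h/τ)(A·KL(ν‖G_N)/(N+1) + B)`;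
* `NoPerpetualDissipationBdd` — the same for the CUT density (fibres of position density `> K` removed),

are both FALSE, by the macrostate-mixture witness `ν = ½(G_N^{(1)} + G_N^{(2)})` of
`…/Negative/HTheoremMixture{Statics,OneBody,Production}.lean` (frame `a = 1`, `θ = 1`, `u₀ = 0`): `ν` is an
admissible initial law at every `σ ≤ 1/2` (probability, `≪ G_N`, `KL(ν‖G_N) ≤ (N+1)S₀`), it is invariant under
every hard-sphere flow, and its (cut or uncut) one-body production is bounded below by the constant `¼ D(r) > 0`
at EVERY time, so the window integral is `≥ ¼ D(r)·h`, linear in the window length `h = τ(N+1)^{-1/3}`, while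
the budget `(h/τ)(A s + B) ≤ (N+1)^{-1/3}(A S₀ + B)` does not grow with `τ`: contradiction for
`τ = 2(A S₀ + B + 1)/c'`, `c' = min(¼ D(r), 1)`. The hard-sphere flow fed to the bet is the regularised Alexander
flow `KineticFluxLdDecayTilt.regFlowCrux`.

MEANING (lead a2, `Cruxes/KineticFluxLdDecay/Lines/h_theorem_dissipation_budget.md`): the deterministic dynamics
conserves energy, hence admits statistical mixtures of invariant Gibbs laws; Boltzmann's production functional of
the ENSEMBLE one-body law reports perpetual dissipation on them although no realisation dissipates. Every `∀ν`
entropy-production budget is therefore false; the line's surviving bet `NoPerpetualDissipationTilt` is stated for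
the crux's own tilted law `G_N^X` only.
-/

noncomputable section

open MeasureTheory ProbabilityTheory Set Filter InformationTheory
open scoped ENNReal NNReal

namespace Summit.AtomisticToContinuum.HydrodynamicLimit.Theorems.HTheorem

open Literature.MathematicalPhysics.KineticTheory (T3 V3 hsDiameter)
open Literature.Analysis.FluidPDE (HardSphereFlow Config)

namespace MixtureWitness

/-- **Window-integrated lower bound, cut form**: `∫₀ʰ 𝒟(cutDensity K of ν at t) dt ≥ ¼ D(r) · h`. -/
theorem lintegral_production_cutDensity_ge {σ : ℝ} (hσ : 0 < σ) (hσ2 : σ ≤ 1 / 2) (N : ℕ) (Φ : Flow σ N)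
    {K : ℝ} (hK : Real.exp (4 * (klConst + 2)) ≤ K) (h : ℝ) :
    ENNReal.ofReal 4⁻¹ * velMixProduction * ENNReal.ofReal h ≤
      ∫⁻ t in Set.Ioo 0 h, production (cutDensity K 1 0 Φ (mixtureLaw σ N Φ) t) := by
  calc ENNReal.ofReal 4⁻¹ * velMixProduction * ENNReal.ofReal h
      = ∫⁻ _ in Set.Ioo 0 h, ENNReal.ofReal 4⁻¹ * velMixProduction := by
        rw [setLIntegral_const, Real.volume_Ioo, sub_zero]
    _ ≤ ∫⁻ t in Set.Ioo 0 h, production (cutDensity K 1 0 Φ (mixtureLaw σ N Φ) t) :=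
        lintegral_mono fun t => quarter_le_production_cutDensity hσ hσ2 N Φ t hK

/-- **Window-integrated lower bound, uncut form**: `∫₀ʰ 𝒟(ρ_t^ν) dt ≥ ¼ D(r) · h`. -/
theorem lintegral_production_oneBodyDensity_ge {σ : ℝ} (hσ : 0 < σ) (hσ2 : σ ≤ 1 / 2) (N : ℕ) (Φ : Flow σ N)
    (h : ℝ) :
    ENNReal.ofReal 4⁻¹ * velMixProduction * ENNReal.ofReal h ≤
      ∫⁻ t in Set.Ioo 0 h, production (oneBodyDensity 1 0 Φ (mixtureLaw σ N Φ) t) := by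
  calc ENNReal.ofReal 4⁻¹ * velMixProduction * ENNReal.ofReal h
      = ∫⁻ _ in Set.Ioo 0 h, ENNReal.ofReal 4⁻¹ * velMixProduction := by
        rw [setLIntegral_const, Real.volume_Ioo, sub_zero]
    _ ≤ ∫⁻ t in Set.Ioo 0 h, production (oneBodyDensity 1 0 Φ (mixtureLaw σ N Φ) t) :=
        lintegral_mono fun t => quarter_le_production_oneBodyDensity hσ hσ2 N Φ t

/-- A positive real `c'` with `ofReal c' ≤ ¼ D(r)` (namely `c' = min(¼ D(r), 1)`; `D(r)` may be infinite). -/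
theorem exists_real_le_quarter_production :
    ∃ c' : ℝ, 0 < c' ∧ ENNReal.ofReal c' ≤ ENNReal.ofReal 4⁻¹ * velMixProduction := by
  set c₁ : ℝ≥0∞ := min (ENNReal.ofReal 4⁻¹ * velMixProduction) 1 with hc₁
  have hc₁top : c₁ ≠ ⊤ := ne_top_of_le_ne_top ENNReal.one_ne_top (min_le_right _ _)
  have hc₁0 : c₁ ≠ 0 :=
    (lt_min (ENNReal.mul_pos (by simp) velMixProduction_ne_zero) zero_lt_one).ne'
  refine ⟨c₁.toReal, ENNReal.toReal_pos hc₁0 hc₁top, ?_⟩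
  rw [ENNReal.ofReal_toReal hc₁top]
  exact min_le_left _ _

/-- **The arithmetic of the contradiction.** A window-integrated lower bound `c' h` (`c' > 0` independent of the
window parameter `τ`) beats the budget `(h/τ)(A k/n + B)` with `k ≤ n S₀` at `τ = 2(A S₀ + B + 1)/c'`. -/
theorem budget_contradiction {c' h A B k n S₀ : ℝ} (hc : 0 < c') (hh : 0 < h) (hA : 0 ≤ A) (hB : 0 ≤ B)
    (hS : 0 ≤ S₀) (hn : 0 < n) (hk0 : 0 ≤ k) (hk : k ≤ n * S₀)
    (hle : ENNReal.ofReal (c' * h) ≤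
      ENNReal.ofReal (h / (2 * (A * S₀ + B + 1) / c') * (A * k / n + B))) : False := by
  set L : ℝ := A * S₀ + B with hL
  have hL0 : 0 ≤ L := by positivity
  have hkn : k / n ≤ S₀ := by rw [div_le_iff₀ hn]; linarith
  have hrhs0 : 0 ≤ h / (2 * (L + 1) / c') * (A * k / n + B) := by positivity
  rw [ENNReal.ofReal_le_ofReal_iff hrhs0] at hle
  have h1 : A * k / n + B ≤ L := by
    rw [hL, mul_div_assoc]
    nlinarith [mul_le_mul_of_nonneg_left hkn hA]
  have h2 : h / (2 * (L + 1) / c') * (A * k / n + B) ≤ h / (2 * (L + 1) / c') * L :=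
    mul_le_mul_of_nonneg_left h1 (by positivity)
  have h3 : h / (2 * (L + 1) / c') * L = c' * h * (L / (2 * (L + 1))) := by
    field_simp
  have h4 : L / (2 * (L + 1)) < 1 := by
    rw [div_lt_one (by positivity)]; linarith
  have h5 : c' * h * (L / (2 * (L + 1))) < c' * h := by
    have := mul_lt_mul_of_pos_left h4 (mul_pos hc hh)
    simpa using this
  linarith

/-- **`NoPerpetualDissipationBdd` is false** (the density-cut `∀ν` H-theorem budget of the line; refuted by the
macrostate mixture `½(G_N^{(1)} + G_N^{(2)})`). -/
theorem not_noPerpetualDissipationBdd : ¬ NoPerpetualDissipationBdd := by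
  intro hBet
  obtain ⟨σ₀, hσ₀, hσ⟩ := hBet 1 1 0 one_pos one_pos
  -- the density
  set σ : ℝ := min (σ₀ / 2) 4⁻¹ with hσdef
  have hσpos : 0 < σ := lt_min (by linarith) (by norm_num)
  have hσlt : σ < σ₀ := (min_le_left _ _).trans_lt (by linarith)
  have hσ4 : σ ≤ 4⁻¹ := min_le_right _ _
  have hσ2 : σ ≤ 1 / 2 := hσ4.trans (by norm_num)
  have hσ' : σ < 2⁻¹ := hσ4.trans_lt (by norm_num)
  -- the cut level
  have hkl := klConst_nonneg
  set K : ℝ := Real.exp (4 * (klConst + 2)) with hKdef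
  have hK1 : 1 ≤ K := Real.one_le_exp (by positivity)
  obtain ⟨A, B, hA, hB, hτ⟩ := hσ σ hσpos hσlt K hK1
  -- the production constant and the window parameter
  obtain ⟨c', hc'0, hc'le⟩ := exists_real_le_quarter_production
  set τ : ℝ := 2 * (A * klConst + B + 1) / c' with hτdef
  have hτpos : 0 < τ := by positivity
  obtain ⟨N₀, hN⟩ := hτ τ hτpos
  -- the flow and the witness
  set Φ : Flow σ N₀ :=
    Summit.AtomisticToContinuum.HydrodynamicLimit.Theorems.KineticFluxLdDecayTilt.regFlowCrux hσpos hσ' N₀ with hΦ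
  haveI := isProbabilityMeasure_mixtureLaw hσ2 N₀ Φ
  haveI := isProbabilityMeasure_gibbs one_pos hσ2 N₀ Φ
  obtain ⟨hkl_ne, hkl_le⟩ := klDiv_mixtureLaw_le hσ2 N₀ Φ
  have hmain := hN N₀ le_rfl Φ (mixtureLaw σ N₀ Φ) inferInstance (mixtureLaw_absolutelyContinuous σ N₀ Φ) hkl_ne
  have hhpos : 0 < window τ N₀ := mul_pos hτpos (Real.rpow_pos_of_pos (by positivity) _)
  -- the lower bound
  have hlow : ENNReal.ofReal (c' * window τ N₀) ≤
      ∫⁻ t in Set.Ioo 0 (window τ N₀), production (cutDensity K 1 0 Φ (mixtureLaw σ N₀ Φ) t) := by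
    rw [ENNReal.ofReal_mul hc'0.le]
    exact (mul_le_mul' hc'le le_rfl).trans (lintegral_production_cutDensity_ge hσpos hσ2 N₀ Φ le_rfl _)
  exact budget_contradiction hc'0 hhpos hA hB hkl (by positivity) ENNReal.toReal_nonneg
    (by simpa [mul_comm] using hkl_le) (hlow.trans hmain)

/-- **`NoPerpetualDissipation` is false** (the uncut `∀ν` H-theorem budget of the line; the same witness —
its uncut production dominates the cut one). The point-density artefact that ALSO refutes this form on paper
(`Lines/h_theorem_dissipation_budget.md`, reshape 1) is not needed. -/
theorem not_noPerpetualDissipation : ¬ NoPerpetualDissipation := by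
  intro hBet
  obtain ⟨σ₀, hσ₀, hσ⟩ := hBet 1 1 0 one_pos one_pos
  set σ : ℝ := min (σ₀ / 2) 4⁻¹ with hσdef
  have hσpos : 0 < σ := lt_min (by linarith) (by norm_num)
  have hσlt : σ < σ₀ := (min_le_left _ _).trans_lt (by linarith)
  have hσ4 : σ ≤ 4⁻¹ := min_le_right _ _
  have hσ2 : σ ≤ 1 / 2 := hσ4.trans (by norm_num)
  have hσ' : σ < 2⁻¹ := hσ4.trans_lt (by norm_num)
  have hkl := klConst_nonneg
  obtain ⟨A, B, hA, hB, hτ⟩ := hσ σ hσpos hσlt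
  obtain ⟨c', hc'0, hc'le⟩ := exists_real_le_quarter_production
  set τ : ℝ := 2 * (A * klConst + B + 1) / c' with hτdef
  have hτpos : 0 < τ := by positivity
  obtain ⟨N₀, hN⟩ := hτ τ hτpos
  set Φ : Flow σ N₀ :=
    Summit.AtomisticToContinuum.HydrodynamicLimit.Theorems.KineticFluxLdDecayTilt.regFlowCrux hσpos hσ' N₀ with hΦ
  haveI := isProbabilityMeasure_mixtureLaw hσ2 N₀ Φ
  haveI := isProbabilityMeasure_gibbs one_pos hσ2 N₀ Φ
  obtain ⟨hkl_ne, hkl_le⟩ := klDiv_mixtureLaw_le hσ2 N₀ Φ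
  have hmain := hN N₀ le_rfl Φ (mixtureLaw σ N₀ Φ) inferInstance (mixtureLaw_absolutelyContinuous σ N₀ Φ) hkl_ne
  have hhpos : 0 < window τ N₀ := mul_pos hτpos (Real.rpow_pos_of_pos (by positivity) _)
  have hlow : ENNReal.ofReal (c' * window τ N₀) ≤
      ∫⁻ t in Set.Ioo 0 (window τ N₀), production (oneBodyDensity 1 0 Φ (mixtureLaw σ N₀ Φ) t) := by
    rw [ENNReal.ofReal_mul hc'0.le]
    exact (mul_le_mul' hc'le le_rfl).trans (lintegral_production_oneBodyDensity_ge hσpos hσ2 N₀ Φ _)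
  exact budget_contradiction hc'0 hhpos hA hB hkl (by positivity) ENNReal.toReal_nonneg
    (by simpa [mul_comm] using hkl_le) (hlow.trans hmain)

end MixtureWitness

end Summit.AtomisticToContinuum.HydrodynamicLimit.Theorems.HTheorem

end
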